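import Summits.FinalStateConjecture.FinalStateConjecture.Theorems.EIHFluxBalanceInertialRecessionRechartClockBallProfile
import Summits.FinalStateConjecture.FinalStateConjecture.Theorems.EIHFluxBalanceInertialRecessionRechartMesh

/-!
# Route EIHFluxBalance — `InertialRecession` (E′), re-charting on the given region: the BALL and
# FLAT profiles of the clock-chart transfer

Helper file for the crux `stmt-FinalStateConjecture-17403`
(`Summit.FinalStateConjecture.FinalStateConjecture.Theses.EIHFluxBalance.InertialRecession`, E′),
line `SketchCleanExcision`, stub `stub_rechartOnRegion` (P2′).

`exists_transfer_profiles_r12`: the ball profile `Rb` of `exists_ball_profile` (…RechartClockBallProfile: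
one monotone step profile `Rb → ∞`, `Rb/t → 0`, meeting every hole's coverage stage, slack, window,
floor and reach constraints after a lab time `T`) together with a CONTINUOUS flat profile `R'`
(floor `R₀`, `R' → ∞`, `R'/t → 0`) with `c·R' ≤ Rb` after `T` — the input of the radiation-zone
package `flat_radiationZone_package_general` (which needs continuity) meshed with the ball profile
(lab points within lab distance `R'` of a centre have painted radius `≤ c·R' ≤ Rb`). The flat profile
is `max R₀ m` for a continuous minorant `m → ∞` of the monotone step function `Rb/c`
(`exists_continuous_minorant`, …RechartMesh). [folklore real analysis]
-/

noncomputable section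

set_option linter.dupNamespace false

open Set Filter Topology

namespace Summit.FinalStateConjecture.FinalStateConjecture.Theorems

/-- A profile with a constant floor tends to `+∞` with the profile (registered carrier
`tendsto_max_const_rechart12` of the crux item). [folklore] -/
theorem tendsto_max_const_rechart12 : open Filter in ∀ {m : ℝ → ℝ} (R₀ : ℝ), Tendsto m atTop atTop → Tendsto (fun t ↦ max R₀ (m t)) atTop atTop :=
  fun _ hm ↦ tendsto_atTop_mono (fun _ ↦ le_max_right _ _) hm

/-- **The ball and flat profiles of the clock-chart transfer.** See the module docstring.
[folklore] -/
theorem exists_transfer_profiles_r12 {N : ℕ} (θ β Rr : Fin N → ℝ → ℝ) (tcov : Fin N → ℕ → ℝ)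
    (B w w' : Fin N → ℝ) (sL S R₀ c : ℝ) (hc : 0 < c) (hR₀ : 0 ≤ R₀)
    (hθtop : ∀ i, Tendsto (θ i) atTop atTop) (hβ0 : ∀ i t, 0 ≤ β i t) (hB : ∀ i, 0 ≤ B i)
    (hw : ∀ i, 0 ≤ w i) (hev : ∀ i (n : ℕ), ∀ᶠ t in atTop, β i t * n ≤ (t - θ i t) + sL)
    (hRrm : ∀ i, Monotone (Rr i)) (hRrt : ∀ i, Tendsto (Rr i) atTop atTop) :
    ∃ (Rb R' : ℝ → ℝ) (T : ℝ), Monotone Rb ∧ Tendsto Rb atTop atTop ∧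
      Tendsto (fun t ↦ Rb t / t) atTop (𝓝 0) ∧ (∀ t, 0 ≤ Rb t) ∧
      Continuous R' ∧ (∀ t, R₀ ≤ R' t) ∧ Tendsto R' atTop atTop ∧
      Tendsto (fun t ↦ R' t / t) atTop (𝓝 0) ∧
      ∀ t, T ≤ t → c * R' t ≤ Rb t ∧ ∀ i, (∃ n : ℕ, Rb t = n ∧ tcov i n ≤ t) ∧
        β i t * Rb t ≤ (t - θ i t) + sL ∧ w i * Rb t + w' i ≤ t / 2 ∧
        S ≤ θ i t - sL - B i * Rb t ∧ Rb t ≤ Rr i (θ i t - B i * Rb t) := by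
  obtain ⟨Rn, hRnm, hRnt, hRnd, T₁, hT₁⟩ := exists_ball_profile θ β Rr (fun _ ↦ sL) B w w' tcov S hθtop hβ0 hB hw
    hev hRrm hRrt
  set Rb : ℝ → ℝ := fun t ↦ (Rn t : ℝ) with hRb
  have hRbm : Monotone Rb := fun s t h ↦ by show (Rn s : ℝ) ≤ Rn t; exact_mod_cast hRnm h
  have hRb0 : ∀ t, 0 ≤ Rb t := fun t ↦ Nat.cast_nonneg _
  -- the continuous minorant of `Rb / c`
  have hqm : Monotone fun t ↦ Rb t / c := fun s t h ↦ div_le_div_of_nonneg_right (hRbm h) hc.le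
  have hqt : Tendsto (fun t ↦ Rb t / c) atTop atTop := hRnt.atTop_div_const hc
  obtain ⟨m, hmc, hmt, hmle⟩ := exists_continuous_minorant hqm hqt
  set R' : ℝ → ℝ := fun t ↦ max R₀ (m t) with hR'
  have hR'c : Continuous R' := continuous_const.max hmc
  have hR'0 : ∀ t, R₀ ≤ R' t := fun t ↦ le_max_left _ _
  have hR't : Tendsto R' atTop atTop := tendsto_max_const_rechart12 R₀ hmt
  -- after `T₂`, `m ≥ R₀`, so `R' = m ≤ Rb / c`
  obtain ⟨T₂, hT₂⟩ := eventually_atTop.1 (hmt.eventually (eventually_ge_atTop R₀))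
  have hR'le : ∀ t, T₂ ≤ t → c * R' t ≤ Rb t := fun t ht ↦ by
    have h1 : R' t = m t := max_eq_right (hT₂ t ht)
    rw [h1]
    have h2 := hmle t
    rwa [le_div_iff₀ hc, mul_comm] at h2
  have hR'd : Tendsto (fun t ↦ R' t / t) atTop (𝓝 0) := by
    have hup : Tendsto (fun t ↦ c⁻¹ * (Rb t / t)) atTop (𝓝 0) := by
      have := hRnd.const_mul c⁻¹
      rwa [mul_zero] at this
    refine tendsto_of_tendsto_of_tendsto_of_le_of_le' tendsto_const_nhds hup ?_ ?_
    · filter_upwards [eventually_gt_atTop 0] with t ht using div_nonneg (hR₀.trans (hR'0 t)) ht.le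
    · filter_upwards [eventually_ge_atTop T₂, eventually_gt_atTop 0] with t hT ht
      rw [← mul_div_assoc, div_le_div_iff_of_pos_right ht, le_inv_mul_iff₀ hc]
      exact hR'le t hT
  refine ⟨Rb, R', max T₁ T₂, hRbm, hRnt, hRnd, hRb0, hR'c, hR'0, hR't, hR'd, fun t ht ↦
    ⟨hR'le t ((le_max_right _ _).trans ht), fun i ↦ ?_⟩⟩
  obtain ⟨-, hall⟩ := hT₁ t ((le_max_left _ _).trans ht)
  obtain ⟨hc', hs, hwin, hS, hR⟩ := hall i
  exact ⟨⟨Rn t, rfl, hc'⟩, hs, hwin, hS, hR⟩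

end Summit.FinalStateConjecture.FinalStateConjecture.Theorems

end
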